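import Mathlib
import Summits.QuantumAdvantage.QuantumAdvantage.Theses.MobiusLadder
import Summits.QuantumAdvantage.QuantumAdvantage.Theorems.MobiusLadderDigitPolyUniformityLAREvalMemLowDeg
import Summits.QuantumAdvantage.QuantumAdvantage.Theorems.MobiusLadderDigitPolyUniformityLARLowDegOneWalsh
import Summits.QuantumAdvantage.QuantumAdvantage.Theorems.MobiusLadderDigitPolyUniformityLARWalshCubeBound
import Summits.QuantumAdvantage.QuantumAdvantage.Theorems.MobiusLadderDigitPolyUniformityLARCorrCubeOfRange
import Summits.QuantumAdvantage.QuantumAdvantage.Theorems.MobiusLadderDigitPolyUniformityLARComposition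
import Summits.QuantumAdvantage.QuantumAdvantage.Theorems.MobiusLadderLiouvilleOrthogonalTC0Junta
import Literature.Computability.MetaComplexity.SmolenskyRows

/-!
# Crux `DigitPolyUniformity` (stmt-QuantumAdvantage-1392): the sub-classes that are ALREADY
# unconditional, in the crux's own form

The crux asks, for every `A` and `ε > 0`, eventually in `n`, `|Σ_{N<2ⁿ} λ(N)(−1)^{P(bits N)}| ≤ ε2ⁿ`
for EVERY `P ∈ 𝔽₂[x_0..x_{n−1}]` of total degree `≤ (log₂ n)^A`. Two sub-classes of such `P` are
settled by what the tree has proved, and this file states them in exactly the crux's vocabulary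
(`MvPolynomial`, `Finset.range (2^n)`, `Nat.testBit`, the phase `if eval = 1 then −1 else 1`), so that a
planner re-lining the crux can cite them and a refuter knows where NOT to look for a correlating phase:

* `digitPolyUniformity_degree_le_one` — **total degree `≤ 1`** (the case `A = 0` of the crux, affine
  phases = `±` Walsh characters): Bourgain's Möbius–Walsh bound for `λ`, PROVED in the tree
  (`WalshLiouvilleBound`, via line Sketch/LAR's cube form `stub_walsh_cube_bound` and
  `stub_lowDeg_one_walsh`);
* `digitPolyUniformity_few_vars` — **polynomials in at most `(log₂ n)^A` of the variables** (any degree,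
  any positions of the digits — low, high or mixed): the junta rung of the `TC⁰` line
  (`LiouvilleOrthogonalTC0.stub_junta`: `λ` is orthogonal to every function of `≤ n^α` digits, from the
  same Walsh bound and the vanishing of a junta's Fourier tail), since `(log₂ n)^A ≤ n^α` eventually.

What remains open is therefore exactly the regime of phases of degree `2 ≤ d ≤ (log₂ n)^A` that involve
UNBOUNDEDLY many digit positions (e.g. the mirror forms `Σ_i x_i x_{n−1−i}`, bent-type phases with flat
Walsh spectrum) — the content of the sibling crux `QuadraticDigitPhases` (stmt-1391) already at `d = 2`
(`quadraticDigitPhases_of_digitPolyUniformity`, `Theorems/…ImpliesQuadratic`).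
-/

set_option linter.dupNamespace false -- D-0017: single-problem summit ⇒ `QuantumAdvantage.QuantumAdvantage` by design

noncomputable section

namespace Summit.QuantumAdvantage.QuantumAdvantage.Theorems.MobiusLadder

open Filter Finset
open Literature.Computability.MetaComplexity (boolFunEquivFin)
open Literature.Computability.MetaComplexity.Smolensky (CubeFn lowDeg)
open Literature.Probability.RandomGraphs.LowDegree (sgn walsh)
open Summit.QuantumAdvantage.DigitPolyUniformity.SketchLAR
  (stub_eval_mem_lowDeg stub_lowDeg_one_walsh stub_walsh_cube_bound)

/-! ### Crux form = cube form, for a given polynomial -/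

/-- **Reindexing**: for any `P`, the crux-form correlation `Σ_{N<2ⁿ} λ(N)(−1)^{[P(bits N)=1]}` equals the
cube-form correlation `Σ_{b ∈ {0,1}ⁿ} λ(val b)(−1)^{[P(b)=1]}` (`val = boolFunEquivFin`, whose digits are
`b`). [folklore] -/
theorem sum_range_phase_eq_sum_cube_eval {n : ℕ} (P : MvPolynomial (Fin n) (ZMod 2)) :
    ∑ N ∈ range (2 ^ n), ((ArithmeticFunction.liouville N : ℤ) : ℝ) *
        (if MvPolynomial.eval (fun i : Fin n => if Nat.testBit N i then (1 : ZMod 2) else 0) P = 1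
          then (-1 : ℝ) else 1) =
      ∑ b : Fin n → Bool, ((ArithmeticFunction.liouville ((boolFunEquivFin n b : Fin (2 ^ n)) : ℕ) : ℤ) : ℝ) *
        (if MvPolynomial.eval (fun i : Fin n => if b i then (1 : ZMod 2) else 0) P = 1
          then (-1 : ℝ) else 1) := by
  rw [Summit.QuantumAdvantage.DigitPolyUniformity.SketchLAR.CorrCubeOfRange.sum_range_eq_sum_cube
    (fun N => ((ArithmeticFunction.liouville N : ℤ) : ℝ) *
      (if MvPolynomial.eval (fun i : Fin n => if Nat.testBit N i then (1 : ZMod 2) else 0) P = 1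
        then (-1 : ℝ) else 1))]
  refine Finset.sum_congr rfl fun b _ => ?_
  have hpt : (fun i : Fin n => if Nat.testBit ((boolFunEquivFin n b : Fin (2 ^ n)) : ℕ) i
      then (1 : ZMod 2) else 0) = fun i => if b i then (1 : ZMod 2) else 0 :=
    funext fun i => by
      rw [Literature.Computability.MetaComplexity.Smolensky.testBit_boolFunEquivFin]
  simp only [hpt]

/-! ### Total degree `≤ 1` (the case `A = 0`): Bourgain's theorem -/

/-- `2^{n − n^c} ≤ ε 2ⁿ` eventually, for `c > 0`. [folklore] -/
theorem two_rpow_sub_rpow_le_eventually {c ε : ℝ} (hc : 0 < c) (hε : 0 < ε) :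
    ∀ᶠ n : ℕ in atTop, (2 : ℝ) ^ ((n : ℝ) - (n : ℝ) ^ c) ≤ ε * 2 ^ n := by
  have hpow : Tendsto (fun n : ℕ => ((n : ℝ) ^ c)) atTop atTop :=
    (tendsto_rpow_atTop hc).comp tendsto_natCast_atTop_atTop
  filter_upwards [hpow.eventually_ge_atTop (Real.logb 2 (1 / ε))] with n hn
  have hle : (2 : ℝ) ^ (-(n : ℝ) ^ c) ≤ ε := by
    have := Real.rpow_le_rpow_of_exponent_le one_lt_two.le (neg_le_neg hn)
    refine this.trans ?_
    rw [Real.rpow_neg zero_le_two, Real.rpow_logb two_pos (by norm_num) (by positivity), one_div, inv_inv]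
  calc (2 : ℝ) ^ ((n : ℝ) - (n : ℝ) ^ c) = 2 ^ (n : ℝ) * 2 ^ (-(n : ℝ) ^ c) := by
        rw [sub_eq_add_neg, Real.rpow_add two_pos]
    _ ≤ 2 ^ (n : ℝ) * ε := mul_le_mul_of_nonneg_left hle (by positivity)
    _ = ε * 2 ^ n := by rw [Real.rpow_natCast]; ring

/-- **The crux for total degree `≤ 1`, unconditionally** (its case `A = 0`): for every `ε > 0`, eventually
in `n`, every `P ∈ 𝔽₂[x_0..x_{n−1}]` of total degree `≤ 1` has `|Σ_{N<2ⁿ} λ(N)(−1)^{P(bits N)}| ≤ ε2ⁿ`.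
The phase of an affine `P` is `±` a Walsh character (`stub_lowDeg_one_walsh`), and Bourgain's bound
`|Σ λ·w_S| ≤ 2^{n−n^c}` holds uniformly in `S` (`stub_walsh_cube_bound`, from the PROVED route item
`WalshLiouvilleBound`; Bourgain 2013, Thm. 1, Liouville form). [folklore] -/
theorem digitPolyUniformity_degree_le_one :
    ∀ ε : ℝ, 0 < ε → ∀ᶠ n : ℕ in atTop, ∀ P : MvPolynomial (Fin n) (ZMod 2), P.totalDegree ≤ 1 →
      |∑ N ∈ range (2 ^ n), ((ArithmeticFunction.liouville N : ℤ) : ℝ) *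
          (if MvPolynomial.eval (fun i : Fin n => if Nat.testBit N i then (1 : ZMod 2) else 0) P = 1
            then (-1 : ℝ) else 1)| ≤ ε * (2 : ℝ) ^ n := by
  intro ε hε
  obtain ⟨c, hc, hwalsh⟩ := stub_walsh_cube_bound
  filter_upwards [hwalsh, two_rpow_sub_rpow_le_eventually hc hε] with n hwn hdn P hP
  set h : CubeFn (ZMod 2) n := fun b =>
    MvPolynomial.eval (fun i : Fin n => if b i then (1 : ZMod 2) else 0) P with hh_def
  have hh : h ∈ lowDeg (ZMod 2) n 1 := stub_eval_mem_lowDeg P hP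
  obtain ⟨S, c', hc', hphase⟩ := stub_lowDeg_one_walsh h hh
  rw [sum_range_phase_eq_sum_cube_eval]
  have hrw : ∑ b : Fin n → Bool,
      ((ArithmeticFunction.liouville ((boolFunEquivFin n b : Fin (2 ^ n)) : ℕ) : ℤ) : ℝ) *
        (if MvPolynomial.eval (fun i : Fin n => if b i then (1 : ZMod 2) else 0) P = 1
          then (-1 : ℝ) else 1) =
      c' * ∑ b : Fin n → Bool,
        ((ArithmeticFunction.liouville ((boolFunEquivFin n b : Fin (2 ^ n)) : ℕ) : ℤ) : ℝ) * walsh S b := by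
    rw [Finset.mul_sum]
    refine Finset.sum_congr rfl fun b _ => ?_
    have hb := hphase b
    simp only [hh_def] at hb
    rw [hb]
    ring
  rw [hrw, abs_mul]
  have habs1 : |c'| = 1 := by
    rcases hc' with rfl | rfl <;> simp
  rw [habs1, one_mul]
  exact (hwn S).trans hdn

/-! ### Polynomials in few variables (juntas): the `TC⁰` line's junta rung -/

/-- Polylogarithms are eventually below any positive power: `(Nat.log 2 n)^A ≤ n^α` eventually, for
`α > 0` (Mathlib's `isLittleO_log_rpow_rpow_atTop` and `Nat.log 2 n ≤ 2 log n`). [folklore] -/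
theorem eventually_natLog_pow_le_rpow (A : ℕ) {α : ℝ} (hα : 0 < α) :
    ∀ᶠ n : ℕ in atTop, ((Nat.log 2 n ^ A : ℕ) : ℝ) ≤ (n : ℝ) ^ α := by
  have hlo := isLittleO_log_rpow_rpow_atTop (A : ℝ) hα
  have hc' : (0 : ℝ) < 1 / 2 ^ A := by positivity
  have hb := tendsto_natCast_atTop_atTop.eventually (hlo.bound hc')
  filter_upwards [hb, eventually_ge_atTop 2] with n hbn h2n
  have hn0 : n ≠ 0 := by omega
  have hlogpos : 0 ≤ Real.log n := Real.log_nonneg (by exact_mod_cast (show 1 ≤ n by omega))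
  rw [Real.rpow_natCast, Real.norm_of_nonneg (pow_nonneg hlogpos A),
    Real.norm_of_nonneg (Real.rpow_nonneg (Nat.cast_nonneg n) α)] at hbn
  have hNL : (Nat.log 2 n : ℝ) ^ A ≤ 2 ^ A * Real.log n ^ A := by
    rw [← mul_pow]
    exact pow_le_pow_left₀ (Nat.cast_nonneg _)
      (Summit.QuantumAdvantage.DigitPolyUniformity.SketchLAR.natLog_two_le_two_mul_log hn0) A
  have hmid : (2 : ℝ) ^ A * Real.log n ^ A ≤ (n : ℝ) ^ α := by
    calc (2 : ℝ) ^ A * Real.log n ^ A ≤ 2 ^ A * (1 / 2 ^ A * (n : ℝ) ^ α) :=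
          mul_le_mul_of_nonneg_left hbn (by positivity)
      _ = (n : ℝ) ^ α := by field_simp
  push_cast
  linarith

/-- The cube evaluation of `P` depends only on the digits in `P.vars`. [folklore] -/
theorem dependsOn_eval_vars {n : ℕ} (P : MvPolynomial (Fin n) (ZMod 2)) :
    DependsOn (fun b : Fin n → Bool =>
      decide (MvPolynomial.eval (fun i : Fin n => if b i then (1 : ZMod 2) else 0) P = 1))
      (↑P.vars : Set (Fin n)) := by
  intro x y hxy
  have hev : MvPolynomial.eval (fun i : Fin n => if x i then (1 : ZMod 2) else 0) P =
      MvPolynomial.eval (fun i : Fin n => if y i then (1 : ZMod 2) else 0) P :=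
    MvPolynomial.eval₂Hom_congr' rfl (fun i hi _ => by rw [hxy i (Finset.mem_coe.2 hi)]) rfl
  simp only [hev]

/-- **The crux for polynomials in at most `(log₂ n)^A` variables, unconditionally**: for every `A` and
`ε > 0`, eventually in `n`, every `P ∈ 𝔽₂[x_0..x_{n−1}]` with `|vars P| ≤ (log₂ n)^A` (any degree, any
positions of the digits) has `|Σ_{N<2ⁿ} λ(N)(−1)^{P(bits N)}| ≤ ε2ⁿ`. From the junta rung of the `TC⁰`
line (`LiouvilleOrthogonalTC0.stub_junta`: functions of `≤ n^α` digits), since `(log₂ n)^A ≤ n^α`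
eventually. [folklore] -/
theorem digitPolyUniformity_few_vars :
    ∀ A : ℕ, ∀ ε : ℝ, 0 < ε → ∀ᶠ n : ℕ in atTop, ∀ P : MvPolynomial (Fin n) (ZMod 2),
      P.vars.card ≤ Nat.log 2 n ^ A →
      |∑ N ∈ range (2 ^ n), ((ArithmeticFunction.liouville N : ℤ) : ℝ) *
          (if MvPolynomial.eval (fun i : Fin n => if Nat.testBit N i then (1 : ZMod 2) else 0) P = 1
            then (-1 : ℝ) else 1)| ≤ ε * (2 : ℝ) ^ n := by
  intro A ε hε
  obtain ⟨α, hα, hJ⟩ :=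
    Summit.QuantumAdvantage.QuantumAdvantage.Theorems.LiouvilleOrthogonalTC0.stub_junta
  filter_upwards [hJ ε hε, eventually_natLog_pow_le_rpow A hα] with n hn hle P hP
  set F : (Fin n → Bool) → Bool := fun b =>
    decide (MvPolynomial.eval (fun i : Fin n => if b i then (1 : ZMod 2) else 0) P = 1) with hF
  have hcard : (P.vars.card : ℝ) ≤ (n : ℝ) ^ α := le_trans (by exact_mod_cast hP) hle
  have hb := hn F P.vars hcard (dependsOn_eval_vars P)
  have hsum : ∑ N ∈ range (2 ^ n), ((ArithmeticFunction.liouville N : ℤ) : ℝ) *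
        (if MvPolynomial.eval (fun i : Fin n => if Nat.testBit N i then (1 : ZMod 2) else 0) P = 1
          then (-1 : ℝ) else 1) =
      ∑ N ∈ range (2 ^ n), ((ArithmeticFunction.liouville N : ℤ) : ℝ) *
        sgn (F (fun i : Fin n => Nat.testBit N i)) := by
    refine Finset.sum_congr rfl fun N _ => ?_
    congr 1
    simp only [hF, sgn]
    by_cases he : MvPolynomial.eval (fun i : Fin n => if Nat.testBit N i then (1 : ZMod 2) else 0) P = 1
    · rw [if_pos he, decide_eq_true he, if_pos rfl]
    · rw [if_neg he, decide_eq_false he]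
      simp
  rw [hsum]
  exact hb

end Summit.QuantumAdvantage.QuantumAdvantage.Theorems.MobiusLadder

end
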